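import Mathlib
import Summits.Parity.GeneralizedHardyLittlewood.Theses.ParityLeakOneFifth
import Summits.Parity.GeneralizedHardyLittlewood.Theorems.ParityLeakOneFifthParityLeakSieveWindowToDensity
import Summits.Parity.GeneralizedHardyLittlewood.Theorems.ParityLeakOneFifthParityLeakSieveCalibration
import Summits.Parity.GeneralizedHardyLittlewood.Theorems.ParityLeakOneFifthParityLeakSieveParityDefect
import Summits.Parity.GeneralizedHardyLittlewood.Theorems.ParityLeakOneFifthParityLeakSieveSieveLowerBound
import HarnessLib

/-!
# Route ParityLeakOneFifth, crux `ParityLeakSieve` (stmt-Parity-18381): the closing theorem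

`ParityLeakSieve : E1NonSaturation → TwinLowerDensity`, assembled from the four landed stubs of
skeleton `birth` exactly as in its kernel-checked composition `ParityLeakSieve_of`: from
`E1NonSaturation` take `η, ε₁`; from S3 (`stub_calibrationLowerBound`) take `c₀, ε₃`; feed
`δ = ηc₀/4` to S1 (`stub_sieveLowerBound`) and S2 (`stub_parityDefectZero`); at
`ε = min (min ε₁ ε₂) (min ε₂' ε₃)` and `x` beyond the four thresholds,
`T ≥ 𝔐 − W_Φ − δX ≥ (Π − δX) − (1 − η)Π − δX = ηΠ − 2δX ≥ (ηc₀/2)·X` (`X = x/log x`), and S4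
(`stub_windowToDensity`) turns this dyadic log-weighted twin bound into `TwinLowerDensity`.
-/

namespace Summit.Parity.GeneralizedHardyLittlewood.Theorems.ParityLeakOneFifth

open Finset Real

/-- **Crux `ParityLeakSieve`** (route `ParityLeakOneFifth`, stmt-Parity-18381): the `(W1)`
lower-bound sieve at `(γ, θ, ν) = (1/2, 0, 1/5)` for the twin host — if the route's one Type-II
functional `W_Φ` fails to saturate (`E1NonSaturation`), the twin primes have positive lower density
on the Hardy–Littlewood scale (`TwinLowerDensity`). -/
theorem parityLeakSieve :
    Summit.Parity.GeneralizedHardyLittlewood.Theses.ParityLeakOneFifth.ParityLeakSieve := by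
  unfold Summit.Parity.GeneralizedHardyLittlewood.Theses.ParityLeakOneFifth.ParityLeakSieve
  intro hE
  unfold Summit.Parity.GeneralizedHardyLittlewood.Theses.ParityLeakOneFifth.E1NonSaturation at hE
  obtain ⟨η, hη, ε₁, hε₁, hE⟩ := hE
  obtain ⟨c₀, hc₀, ε₃, hε₃, hC⟩ := stub_calibrationLowerBound
  have hδ : 0 < η * c₀ / 4 := by positivity
  obtain ⟨ε₂, hε₂, hS⟩ := stub_sieveLowerBound (η * c₀ / 4) hδ
  obtain ⟨ε₂', hε₂', hP⟩ := stub_parityDefectZero (η * c₀ / 4) hδ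
  obtain ⟨ε, hεpos, hle₁, hle₂, hle₂', hle₃⟩ :
      ∃ ε : ℝ, 0 < ε ∧ ε ≤ ε₁ ∧ ε ≤ ε₂ ∧ ε ≤ ε₂' ∧ ε ≤ ε₃ :=
    ⟨min (min ε₁ ε₂) (min ε₂' ε₃), lt_min (lt_min hε₁ hε₂) (lt_min hε₂' hε₃),
      (min_le_left _ _).trans (min_le_left _ _), (min_le_left _ _).trans (min_le_right _ _),
      (min_le_right _ _).trans (min_le_left _ _), (min_le_right _ _).trans (min_le_right _ _)⟩
  obtain ⟨x₁, hx₁⟩ := hE ε hεpos hle₁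
  obtain ⟨x₂, hx₂⟩ := hS ε hεpos hle₂
  obtain ⟨x₃, hx₃⟩ := hP ε hεpos hle₂'
  obtain ⟨x₄, hx₄⟩ := hC ε hεpos hle₃
  apply stub_windowToDensity
  refine ⟨η * c₀ / 2, by positivity, max (max x₁ x₂) (max x₃ x₄), fun x hx => ?_⟩
  have hx₁' : x₁ ≤ x := ((le_max_left _ _).trans (le_max_left _ _)).trans hx
  have hx₂' : x₂ ≤ x := ((le_max_right _ _).trans (le_max_left _ _)).trans hx
  have hx₃' : x₃ ≤ x := ((le_max_left _ _).trans (le_max_right _ _)).trans hx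
  have hx₄' : x₄ ≤ x := ((le_max_right _ _).trans (le_max_right _ _)).trans hx
  -- names for `W_Φ`, `Π`, `𝔐`, `T`, `X` at this `x, ε`
  obtain ⟨WΦ, hWΦ⟩ : ∃ v : ℝ, v = ∑ n ∈ Finset.Ioc x (2 * x),
      (if (x : ℝ) ^ (ε ^ 2) ≤ ((n + 2).minFac : ℝ) ∧ ((n + 2).minFac : ℝ) < (x : ℝ) ^ ((1 : ℝ) / 5)
        then ∑ d ∈ (Nat.divisors (n + 2)).filter (fun d : ℕ => (d : ℝ) ≤ (x : ℝ) ^ ((1 : ℝ) / 2 - 2 * ε) ∧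
          ∀ p ∈ d.primeFactors, (x : ℝ) ^ ((1 : ℝ) / 5) ≤ (p : ℝ)), (ArithmeticFunction.moebius d : ℝ)
        else 0) *
      ((if n.Prime then Real.log (n : ℝ) else 0) -
        (if ∀ p ∈ n.primeFactors, Real.exp (Real.log (Real.log (x : ℝ)) ^ 2) ≤ (p : ℝ) then
          1 / (∏ p ∈ (Finset.range ⌈Real.exp (Real.log (Real.log (x : ℝ)) ^ 2)⌉₊).filter Nat.Prime,
            (1 - 1 / (p : ℝ))) else 0)) := ⟨_, rfl⟩
  obtain ⟨Pv, hPv⟩ : ∃ v : ℝ, v = ∑ n ∈ Finset.Ioc x (2 * x),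
      (if ∀ p ∈ n.primeFactors, Real.exp (Real.log (Real.log (x : ℝ)) ^ 2) ≤ (p : ℝ) then
          1 / (∏ p ∈ (Finset.range ⌈Real.exp (Real.log (Real.log (x : ℝ)) ^ 2)⌉₊).filter Nat.Prime,
            (1 - 1 / (p : ℝ))) else 0) *
      (ArithmeticFunction.liouville (n + 2) : ℝ) *
      (if (x : ℝ) ^ (ε ^ 2) ≤ ((n + 2).minFac : ℝ) ∧ ((n + 2).minFac : ℝ) < (x : ℝ) ^ ((1 : ℝ) / 5)
        then ∑ d ∈ (Nat.divisors (n + 2)).filter (fun d : ℕ => (d : ℝ) ≤ (x : ℝ) ^ ((1 : ℝ) / 2 - 2 * ε) ∧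
          ∀ p ∈ d.primeFactors, (x : ℝ) ^ ((1 : ℝ) / 5) ≤ (p : ℝ)), (ArithmeticFunction.moebius d : ℝ)
        else 0) := ⟨_, rfl⟩
  obtain ⟨Mv, hMv⟩ : ∃ v : ℝ, v = ∑ n ∈ Finset.Ioc x (2 * x),
      (if ∀ p ∈ n.primeFactors, Real.exp (Real.log (Real.log (x : ℝ)) ^ 2) ≤ (p : ℝ) then
          1 / (∏ p ∈ (Finset.range ⌈Real.exp (Real.log (Real.log (x : ℝ)) ^ 2)⌉₊).filter Nat.Prime,
            (1 - 1 / (p : ℝ))) else 0) *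
      (if (x : ℝ) ^ ((1 : ℝ) / 5) ≤ ((n + 2).minFac : ℝ)
        then ∑ d ∈ (Nat.divisors (n + 2)).filter (fun d : ℕ => (d : ℝ) ≤ (x : ℝ) ^ ((1 : ℝ) / 2 - 2 * ε) ∧
          ∀ p ∈ d.primeFactors, (x : ℝ) ^ ((1 : ℝ) / 5) ≤ (p : ℝ)), (ArithmeticFunction.moebius d : ℝ)
        else 0) := ⟨_, rfl⟩
  obtain ⟨Tv, hTv⟩ : ∃ v : ℝ, v = ∑ n ∈ (Finset.Ioc x (2 * x)).filter (fun n : ℕ => n.Prime ∧ (n + 2).Prime),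
      Real.log (n : ℝ) := ⟨_, rfl⟩
  obtain ⟨X, hX⟩ : ∃ v : ℝ, v = (x : ℝ) / Real.log (x : ℝ) := ⟨_, rfl⟩
  -- W_Φ ≤ (1 − η)Π ;  𝔐 − W_Φ − δX ≤ T ;  Π − δX ≤ 𝔐 ;  c₀X ≤ Π
  have hW : WΦ ≤ (1 - η) * Pv := by rw [hWΦ, hPv]; exact hx₁ x hx₁'
  have hT : Mv - WΦ - η * c₀ / 4 * (x : ℝ) / Real.log (x : ℝ) ≤ Tv := by
    rw [hMv, hWΦ, hTv]; exact hx₂ x hx₂'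
  have hM : Pv - η * c₀ / 4 * (x : ℝ) / Real.log (x : ℝ) ≤ Mv := by
    rw [hPv, hMv]; exact hx₃ x hx₃'
  have hPi : c₀ * (x : ℝ) / Real.log (x : ℝ) ≤ Pv := by rw [hPv]; exact hx₄ x hx₄'
  have key : ∀ t : ℝ, t * (x : ℝ) / Real.log (x : ℝ) = t * X := fun t => by
    rw [hX]; exact mul_div_assoc _ _ _
  rw [key] at hT hM hPi
  have hEtaPi : η * (c₀ * X) ≤ η * Pv := mul_le_mul_of_nonneg_left hPi hη.le
  have hfin : η * c₀ / 2 * X ≤ Tv := by linarith [hW, hT, hM, hEtaPi]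
  exact (key (η * c₀ / 2)).le.trans (hfin.trans hTv.le)

end Summit.Parity.GeneralizedHardyLittlewood.Theorems.ParityLeakOneFifth
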